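import Literature.Analysis.FluidPDE.TorusWordSobolev
import Literature.Analysis.FluidPDE.PeriodicCylinderExtension
import Literature.Analysis.FunctionSpaces.TorusVerticalLift
import Literature.Analysis.FunctionSpaces.TorusPeriodization
import Mathlib.MeasureTheory.Function.Jacobian
import HarnessLib

/-!
# The period box of the periodic cylinder read on the flat 3-torus: word derivatives and
# `L²` norms under the transfer

Analysis/FluidPDE support file for the energy-method construction of Euler flows in the periodic
cylinder (`Literature.Analysis.FluidPDE.KatoLai1984_periodicCylinderUniformExistence`): the
evolution is run on the flat torus `T³ = ℝ³/ℤ³` (where the tree's Fourier machinery lives), while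
the physical fields live on the period box `B_L = (-2, 2)² × (0, L) ⊃ cell L` of `ℝ³`, are
`L`-periodic in `z` and vanish for `|x₀| ≥ 5/4` or `|x₁| ≥ 5/4` (the range of the radial Seeley
extension `PeriodicCylinder.cylExtend`, supported in `{r < 5/4}`). This file fixes the dictionary
and proves that it respects coordinate word derivatives and `L²` norms up to explicit factors:

* `PeriodicCylinder.boxMap L y = (4y₀ - 2, 4y₁ - 2, L y₂)` — the affine diffeomorphism of `ℝ³`
  taking the unit cube onto `B_L` (derivative `boxLin L = diag(4, 4, L)`, `det = 16 L`), and its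
  inverse `boxInv L`; `boxMap L '' openCube = openBox L`;
* `Torus.lift_wordDeriv` — on any torus, **lifts of word derivatives are the iterated directional
  derivatives of the lift** along the coordinate vectors (`Torus.wordVecs`);
* `iterDirDeriv_comp_boxMap` / `iterDirDeriv_comp_boxInv` — **chain rule through the box map**:
  `∂_w (g ∘ boxMap L) = boxScale L w • (∂_w g) ∘ boxMap L`, `boxScale L w = ∏_{i ∈ w} aᵢ`,
  `a = (4, 4, L)`;
* `PeriodicCylinder.toTorus L E ξ = E (boxMap L (repr ξ))` — **reading a box field on `T³`**:
  smooth (`isSmooth_toTorus`, via the tree's `Torus.isSmooth_comp_repr`) when `E` is smooth,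
  `L`-periodic in `z` and vanishes for `|x₀| ≥ 5/4 ∨ |x₁| ≥ 5/4`; on the open unit cube its lift
  is `E ∘ boxMap L` to all orders (`iterDirDeriv_lift_toTorus`), whence the exact transfer
  **`∫_{T³} ‖∂_w (toTorus L E)‖ₑ² = (boxScale L w)² (16L)⁻¹ ∫_{B_L} ‖∂_w E‖ₑ²`**
  (`lintegral_wordDeriv_toTorus_sq`);
* `PeriodicCylinder.fromTorus L V = lift V ∘ boxInv L` — **reading a torus field on `ℝ³`**
  (smooth, `L`-periodic in `z`), with
  **`∫_{B_L} ‖∂_w (fromTorus L V)‖ₑ² = 16 L (boxScale L w)⁻² ∫_{T³} ‖∂_w V‖ₑ²`**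
  (`lintegral_iterDirDeriv_fromTorus_sq`), and `fromTorus L (toTorus L E) = E` on
  `[-2, 2)² × ℝ` for `z`-periodic `E` (`fromTorus_toTorus_apply`).

Everything is proved; no named fact and no `sorry` is introduced.

## Mathlib / tree search

Tree: `Torus.repr`, `Torus.proj`, `Torus.lift`, `Torus.unitCube`,
`Torus.repr_proj_of_mem_unitCube_holds`, `Torus.setLIntegral_unitCube_lift`,
`Torus.isSmooth_comp_repr`, `Torus.repr_proj_apply` (`FlatTorus(Proofs)`, `TorusPeriodization`,
`TorusVerticalLift`); `Torus.lift_lineDeriv` (`TorusCalculus`); `Torus.wordDeriv`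
(`TorusWordSobolev`); `iterDirDeriv`, `contDiff_iterDirDeriv`, `eventuallyEq_iterDirDeriv`
(`RegularizedDistance`); `volume_setOf_apply_two_eq` pattern (`Ferrari1993LogEstimateReduction`).
Mathlib: `lintegral_image_eq_lintegral_abs_det_fderiv_mul`, `Measure.pi_hyperplane`,
`LinearMap.det_toMatrix`, `Matrix.det_diagonal`.

## References

* L. Grafakos, *Classical Fourier Analysis*, 3rd ed., Springer 2014, §3.1.1 (functions on `Tⁿ` as
  periodic functions on `ℝⁿ`). [Grafakos2014]
* T. Kato, C. Y. Lai, J. Funct. Anal. 56 (1984) 15–28, §7, (7.1) (extension of the data to a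
  neighbourhood and restriction back). [KatoLai1984]
-/

noncomputable section

open MeasureTheory Set Function Filter Topology TopologicalSpace WithLp
open scoped ContDiff NNReal ENNReal

namespace Literature.Analysis.FluidPDE

open FunctionSpaces FunctionSpaces.Torus

/-! ### Lifts of word derivatives on any torus -/

namespace Torus

universe u

variable {d : Type u} [Fintype d] [DecidableEq d] {F : Type*} [NormedAddCommGroup F] [NormedSpace ℝ F]

/-- The list of coordinate vectors `e_{w₁}, …, e_{w_n}` of a word `w`. [folklore] -/
def wordVecs (w : List d) : List (EuclideanSpace ℝ d) := w.map fun i => EuclideanSpace.single i (1 : ℝ)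

omit [Fintype d] in
/-- `wordVecs` of a cons. [folklore] -/
@[simp] theorem wordVecs_cons (i : d) (w : List d) :
    wordVecs (i :: w) = EuclideanSpace.single i (1 : ℝ) :: wordVecs w := rfl

omit [Fintype d] in
/-- `wordVecs` of nil. [folklore] -/
@[simp] theorem wordVecs_nil : wordVecs ([] : List d) = [] := rfl

omit [Fintype d] in
/-- The length of `wordVecs`. [folklore] -/
@[simp] theorem length_wordVecs (w : List d) : (wordVecs w).length = w.length := by simp [wordVecs]

/-- **Lifts of word derivatives are iterated directional derivatives of the lift**:
`lift (∂_w V) = ∂_{e_{w₁}} ⋯ ∂_{e_{w_n}} (lift V)` for smooth `V`. [folklore] -/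
theorem lift_wordDeriv {V : UnitAddTorus d → F} (hV : IsSmooth V) : ∀ w : List d,
    lift (wordDeriv w V) = iterDirDeriv (wordVecs w) (lift V)
  | [] => rfl
  | i :: w => by
    rw [wordDeriv_cons, wordVecs_cons, iterDirDeriv_cons, ← lift_wordDeriv hV w]
    exact lift_lineDeriv ((isSmooth_wordDeriv hV w).isContDiff (by simp)) _

/-- The square-`ℒ²`-density `‖∂_w V‖ₑ²` of a smooth field is a.e.-measurable on the torus.
[folklore] -/
theorem aemeasurable_enorm_wordDeriv_sq {V : UnitAddTorus d → F} (hV : IsSmooth V) (w : List d) :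
    AEMeasurable (fun ξ => ‖wordDeriv w V ξ‖ₑ ^ 2) volume :=
  ((ENNReal.continuous_pow 2).comp (isSmooth_wordDeriv hV w).continuous.enorm).measurable.aemeasurable

end Torus

/-- Local notation for physical space `ℝ³ = EuclideanSpace ℝ (Fin 3)`. -/
local notation "ℝ³" => EuclideanSpace ℝ (Fin 3)

namespace PeriodicCylinder

variable {F : Type*} [NormedAddCommGroup F] [NormedSpace ℝ F]

/-- Extensionality in `ℝ³` by the three coordinates. [folklore] -/
theorem ext3 {x y : ℝ³} (h0 : x 0 = y 0) (h1 : x 1 = y 1) (h2 : x 2 = y 2) : x = y := by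
  ext i
  fin_cases i
  exacts [h0, h1, h2]

/-! ### The box map and its inverse -/

/-- The side lengths `a = (4, 4, L)` of the period box. [folklore] -/
def boxSide (L : ℝ) (i : Fin 3) : ℝ := ![4, 4, L] i

/-- `a₀ = 4`. [folklore] -/
@[simp] theorem boxSide_zero (L : ℝ) : boxSide L 0 = 4 := rfl
/-- `a₁ = 4`. [folklore] -/
@[simp] theorem boxSide_one (L : ℝ) : boxSide L 1 = 4 := rfl
/-- `a₂ = L`. [folklore] -/
@[simp] theorem boxSide_two (L : ℝ) : boxSide L 2 = L := rfl

/-- The sides are positive for `L > 0`. [folklore] -/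
theorem boxSide_pos {L : ℝ} (hL : 0 < L) (i : Fin 3) : 0 < boxSide L i := by
  fin_cases i <;> simp [boxSide, hL]

/-- The sides are nonzero for `L ≠ 0`. [folklore] -/
theorem boxSide_ne_zero {L : ℝ} (hL : L ≠ 0) (i : Fin 3) : boxSide L i ≠ 0 := by
  fin_cases i <;> simp [boxSide, hL]

/-- `aᵢ ≤ max 4 L`. [folklore] -/
theorem boxSide_le_max (L : ℝ) (i : Fin 3) : boxSide L i ≤ max 4 L := by
  fin_cases i <;> simp [boxSide]

/-- `min 4 L ≤ aᵢ`. [folklore] -/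
theorem min_le_boxSide (L : ℝ) (i : Fin 3) : min 4 L ≤ boxSide L i := by
  fin_cases i <;> simp [boxSide]

/-- The offsets `c = (-2, -2, 0)` of the box map. [folklore] -/
def boxOff (i : Fin 3) : ℝ := ![-2, -2, 0] i

/-- `c₀ = -2`. [folklore] -/
@[simp] theorem boxOff_zero : boxOff 0 = -2 := rfl
/-- `c₁ = -2`. [folklore] -/
@[simp] theorem boxOff_one : boxOff 1 = -2 := rfl
/-- `c₂ = 0`. [folklore] -/
@[simp] theorem boxOff_two : boxOff 2 = 0 := rfl

/-- The linear part `diag(4, 4, L)` of the box map, as a linear map. [folklore] -/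
def boxLinₗ (L : ℝ) : ℝ³ →ₗ[ℝ] ℝ³ where
  toFun y := toLp 2 fun i => boxSide L i * y i
  map_add' y z := by
    ext i
    simp only [PiLp.add_apply, mul_add]
  map_smul' c y := by
    ext i
    simp only [PiLp.smul_apply, smul_eq_mul, RingHom.id_apply, mul_left_comm]

/-- **The linear part** `diag(4, 4, L)` of the box map. [folklore] -/
def boxLin (L : ℝ) : ℝ³ →L[ℝ] ℝ³ := LinearMap.toContinuousLinearMap (boxLinₗ L)

/-- Coordinates of `boxLin`. [folklore] -/
@[simp] theorem boxLin_apply (L : ℝ) (y : ℝ³) (i : Fin 3) : boxLin L y i = boxSide L i * y i := rfl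

/-- `boxLin L eᵢ = aᵢ eᵢ`. [folklore] -/
theorem boxLin_single (L : ℝ) (i : Fin 3) :
    boxLin L (EuclideanSpace.single i (1 : ℝ)) = boxSide L i • EuclideanSpace.single i (1 : ℝ) := by
  ext j
  rw [boxLin_apply, PiLp.smul_apply, smul_eq_mul]
  by_cases h : j = i
  · subst h; simp
  · simp [h]

/-- **The box map** `y ↦ (4y₀ - 2, 4y₁ - 2, L y₂)`, taking the unit cube onto the period box.
[folklore] -/
def boxMap (L : ℝ) (y : ℝ³) : ℝ³ := toLp 2 fun i => boxSide L i * y i + boxOff i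

/-- Coordinates of the box map. [folklore] -/
theorem boxMap_apply (L : ℝ) (y : ℝ³) (i : Fin 3) : boxMap L y i = boxSide L i * y i + boxOff i := rfl

/-- `(boxMap L y)₀ = 4y₀ - 2`. [folklore] -/
@[simp] theorem boxMap_apply_zero (L : ℝ) (y : ℝ³) : boxMap L y 0 = 4 * y 0 - 2 := by
  rw [boxMap_apply, boxSide_zero, boxOff_zero, sub_eq_add_neg]
/-- `(boxMap L y)₁ = 4y₁ - 2`. [folklore] -/
@[simp] theorem boxMap_apply_one (L : ℝ) (y : ℝ³) : boxMap L y 1 = 4 * y 1 - 2 := by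
  rw [boxMap_apply, boxSide_one, boxOff_one, sub_eq_add_neg]
/-- `(boxMap L y)₂ = L y₂`. [folklore] -/
@[simp] theorem boxMap_apply_two (L : ℝ) (y : ℝ³) : boxMap L y 2 = L * y 2 := by
  rw [boxMap_apply, boxSide_two, boxOff_two, add_zero]

/-- `boxMap L y = boxLin L y + c`. [folklore] -/
theorem boxMap_eq (L : ℝ) (y : ℝ³) : boxMap L y = boxLin L y + toLp 2 boxOff := by
  ext i; rfl

/-- The box map is smooth (affine). [folklore] -/
theorem contDiff_boxMap (L : ℝ) {n : WithTop ℕ∞} : ContDiff ℝ n (boxMap L) := by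
  rw [show boxMap L = fun y => boxLin L y + toLp 2 boxOff from funext (boxMap_eq L)]
  exact (boxLin L).contDiff.add contDiff_const

/-- The derivative of the box map is its linear part. [folklore] -/
theorem hasFDerivAt_boxMap (L : ℝ) (y : ℝ³) : HasFDerivAt (boxMap L) (boxLin L) y := by
  rw [show boxMap L = fun y => boxLin L y + toLp 2 boxOff from funext (boxMap_eq L)]
  exact (boxLin L).hasFDerivAt.add_const _

/-- **The inverse box map** `x ↦ ((x₀ + 2)/4, (x₁ + 2)/4, x₂/L)`. [folklore] -/
def boxInv (L : ℝ) (x : ℝ³) : ℝ³ := toLp 2 fun i => (boxSide L i)⁻¹ * (x i - boxOff i)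

/-- Coordinates of the inverse box map. [folklore] -/
theorem boxInv_apply (L : ℝ) (x : ℝ³) (i : Fin 3) :
    boxInv L x i = (boxSide L i)⁻¹ * (x i - boxOff i) := rfl

/-- `(boxInv L x)₀ = (x₀ + 2)/4`. [folklore] -/
@[simp] theorem boxInv_apply_zero (L : ℝ) (x : ℝ³) : boxInv L x 0 = (x 0 + 2) / 4 := by
  rw [boxInv_apply, boxSide_zero, boxOff_zero, sub_neg_eq_add, inv_mul_eq_div]
/-- `(boxInv L x)₁ = (x₁ + 2)/4`. [folklore] -/
@[simp] theorem boxInv_apply_one (L : ℝ) (x : ℝ³) : boxInv L x 1 = (x 1 + 2) / 4 := by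
  rw [boxInv_apply, boxSide_one, boxOff_one, sub_neg_eq_add, inv_mul_eq_div]
/-- `(boxInv L x)₂ = x₂/L`. [folklore] -/
@[simp] theorem boxInv_apply_two (L : ℝ) (x : ℝ³) : boxInv L x 2 = x 2 / L := by
  rw [boxInv_apply, boxSide_two, boxOff_two, sub_zero, inv_mul_eq_div]

/-- `boxMap ∘ boxInv = id` for `L ≠ 0`. [folklore] -/
@[simp] theorem boxMap_boxInv {L : ℝ} (hL : L ≠ 0) (x : ℝ³) : boxMap L (boxInv L x) = x := by
  ext i
  rw [boxMap_apply, boxInv_apply, ← mul_assoc, mul_inv_cancel₀ (boxSide_ne_zero hL i), one_mul,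
    sub_add_cancel]

/-- `boxInv ∘ boxMap = id` for `L ≠ 0`. [folklore] -/
@[simp] theorem boxInv_boxMap {L : ℝ} (hL : L ≠ 0) (y : ℝ³) : boxInv L (boxMap L y) = y := by
  ext i
  rw [boxInv_apply, boxMap_apply, add_sub_cancel_right, ← mul_assoc,
    inv_mul_cancel₀ (boxSide_ne_zero hL i), one_mul]

/-- The box map is injective for `L ≠ 0`. [folklore] -/
theorem boxMap_injective {L : ℝ} (hL : L ≠ 0) : Injective (boxMap L) := fun y z h => by
  rw [← boxInv_boxMap hL y, ← boxInv_boxMap hL z, h]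

/-- The linear part `diag(1/4, 1/4, 1/L)` of the inverse box map, as a linear map. [folklore] -/
def boxInvLinₗ (L : ℝ) : ℝ³ →ₗ[ℝ] ℝ³ where
  toFun y := toLp 2 fun i => (boxSide L i)⁻¹ * y i
  map_add' y z := by
    ext i
    simp only [PiLp.add_apply, mul_add]
  map_smul' c y := by
    ext i
    simp only [PiLp.smul_apply, smul_eq_mul, RingHom.id_apply, mul_left_comm]

/-- The linear part `diag(1/4, 1/4, 1/L)` of the inverse box map. [folklore] -/
def boxInvLin (L : ℝ) : ℝ³ →L[ℝ] ℝ³ := LinearMap.toContinuousLinearMap (boxInvLinₗ L)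

/-- Coordinates of `boxInvLin`. [folklore] -/
@[simp] theorem boxInvLin_apply (L : ℝ) (y : ℝ³) (i : Fin 3) : boxInvLin L y i = (boxSide L i)⁻¹ * y i := rfl

/-- `boxInv L x = boxInvLin L x + const`. [folklore] -/
theorem boxInv_eq (L : ℝ) (x : ℝ³) :
    boxInv L x = boxInvLin L x + toLp 2 fun i => -((boxSide L i)⁻¹ * boxOff i) := by
  ext i
  rw [boxInv_apply, PiLp.add_apply, boxInvLin_apply, PiLp.toLp_apply]
  ring

/-- The inverse box map is smooth. [folklore] -/
theorem contDiff_boxInv (L : ℝ) {n : WithTop ℕ∞} : ContDiff ℝ n (boxInv L) := by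
  rw [show boxInv L = fun x => boxInvLin L x + toLp 2 fun i => -((boxSide L i)⁻¹ * boxOff i)
    from funext (boxInv_eq L)]
  exact (boxInvLin L).contDiff.add contDiff_const

/-! ### The open cube, the open box, and the change of variables -/

/-- The open unit cube `(0, 1)³`. [folklore] -/
def openCube : Set ℝ³ := {y | ∀ i, y i ∈ Ioo (0 : ℝ) 1}

/-- **The open period box** `B_L = (-2, 2)² × (0, L)`. [folklore] -/
def openBox (L : ℝ) : Set ℝ³ := {x | x 0 ∈ Ioo (-2 : ℝ) 2 ∧ x 1 ∈ Ioo (-2 : ℝ) 2 ∧ x 2 ∈ Ioo 0 L}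

/-- Membership in the open box. [folklore] -/
theorem mem_openBox_iff {L : ℝ} {x : ℝ³} :
    x ∈ openBox L ↔ x 0 ∈ Ioo (-2 : ℝ) 2 ∧ x 1 ∈ Ioo (-2 : ℝ) 2 ∧ x 2 ∈ Ioo 0 L := Iff.rfl

/-- The open cube is open. [folklore] -/
theorem isOpen_openCube : IsOpen (openCube : Set ℝ³) := by
  have : (openCube : Set ℝ³) = ⋂ i, (fun y : ℝ³ => y i) ⁻¹' Ioo 0 1 := by
    ext y; simp [openCube]
  rw [this]
  exact isOpen_iInter_of_finite fun i => isOpen_Ioo.preimage (PiLp.continuous_apply 2 _ i)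

/-- The open box is open. [folklore] -/
theorem isOpen_openBox (L : ℝ) : IsOpen (openBox L : Set ℝ³) := by
  have : (openBox L : Set ℝ³) = ((fun y : ℝ³ => y 0) ⁻¹' Ioo (-2) 2 ∩ (fun y : ℝ³ => y 1) ⁻¹' Ioo (-2) 2) ∩
      (fun y : ℝ³ => y 2) ⁻¹' Ioo 0 L := by
    ext y; simp only [openBox, mem_setOf_eq, mem_inter_iff, mem_preimage, and_assoc]
  rw [this]
  exact ((isOpen_Ioo.preimage (PiLp.continuous_apply 2 (fun _ : Fin 3 => ℝ) 0)).inter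
    (isOpen_Ioo.preimage (PiLp.continuous_apply 2 (fun _ : Fin 3 => ℝ) 1))).inter
      (isOpen_Ioo.preimage (PiLp.continuous_apply 2 (fun _ : Fin 3 => ℝ) 2))

/-- The open cube lies in the half-open unit cube of the torus library. [folklore] -/
theorem openCube_subset_unitCube : (openCube : Set ℝ³) ⊆ unitCube (Fin 3) :=
  fun _ hy => mem_unitCube.2 fun i => Ioo_subset_Ico_self (hy i)

/-- **`boxMap L` takes the open cube onto the open box** (`L > 0`). [folklore] -/
theorem image_boxMap_openCube {L : ℝ} (hL : 0 < L) : boxMap L '' openCube = openBox L := by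
  refine Subset.antisymm ?_ fun x hx => ?_
  · rintro _ ⟨y, hy, rfl⟩
    have h0 := hy 0
    have h1 := hy 1
    have h2 := hy 2
    refine ⟨⟨?_, ?_⟩, ⟨?_, ?_⟩, ⟨?_, ?_⟩⟩
    · rw [boxMap_apply_zero]; linarith [h0.1]
    · rw [boxMap_apply_zero]; linarith [h0.2]
    · rw [boxMap_apply_one]; linarith [h1.1]
    · rw [boxMap_apply_one]; linarith [h1.2]
    · rw [boxMap_apply_two]; exact mul_pos hL h2.1
    · rw [boxMap_apply_two]; nlinarith [h2.2]
  · obtain ⟨h0, h1, h2⟩ := hx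
    refine ⟨boxInv L x, ?_, boxMap_boxInv hL.ne' x⟩
    have c0 : boxInv L x 0 ∈ Ioo (0 : ℝ) 1 := by
      rw [boxInv_apply_zero]; constructor <;> linarith [h0.1, h0.2]
    have c1 : boxInv L x 1 ∈ Ioo (0 : ℝ) 1 := by
      rw [boxInv_apply_one]; constructor <;> linarith [h1.1, h1.2]
    have c2 : boxInv L x 2 ∈ Ioo (0 : ℝ) 1 := by
      rw [boxInv_apply_two]
      exact ⟨div_pos h2.1 hL, (div_lt_one hL).2 h2.2⟩
    intro i
    fin_cases i
    exacts [c0, c1, c2]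

/-- Coordinate hyperplanes `{xᵢ = c}` are Lebesgue null in `ℝ³`. [folklore] -/
theorem volume_setOf_apply_eq (i : Fin 3) (c : ℝ) : volume {x : ℝ³ | x i = c} = 0 := by
  have hmp : MeasurePreserving (ofLp : ℝ³ → (Fin 3 → ℝ)) volume volume :=
    PiLp.volume_preserving_ofLp (Fin 3)
  have hset : {x : ℝ³ | x i = c} = (ofLp : ℝ³ → (Fin 3 → ℝ)) ⁻¹' {y | y i = c} := rfl
  have hmeas : MeasurableSet {y : Fin 3 → ℝ | y i = c} :=
    measurableSet_eq_fun (measurable_pi_apply i) measurable_const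
  rw [hset, hmp.measure_preimage hmeas.nullMeasurableSet, volume_pi]
  exact Measure.pi_hyperplane (fun _ : Fin 3 => (volume : Measure ℝ)) i c

/-- The half-open and the open unit cube agree a.e. [folklore] -/
theorem openCube_ae_eq_unitCube : (openCube : Set ℝ³) =ᵐ[volume] unitCube (Fin 3) := by
  refine (ae_eq_set).2 ⟨?_, ?_⟩
  · exact measure_mono_null (fun y hy => absurd (openCube_subset_unitCube hy.1) hy.2) measure_empty
  · refine measure_mono_null (fun y hy => ?_) (measure_iUnion_null fun i => volume_setOf_apply_eq i 0)
    obtain ⟨hyU, hyO⟩ := hy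
    simp only [openCube, mem_setOf_eq, not_forall] at hyO
    obtain ⟨i, hi⟩ := hyO
    have hi' := (mem_unitCube.1 hyU) i
    refine mem_iUnion.2 ⟨i, ?_⟩
    show y i = 0
    by_contra hne
    exact hi ⟨lt_of_le_of_ne hi'.1 (Ne.symm hne), hi'.2⟩

/-- The matrix of `boxLin L` in the standard basis is `diag(4, 4, L)`. [folklore] -/
theorem toMatrix_boxLin (L : ℝ) :
    LinearMap.toMatrix (EuclideanSpace.basisFun (Fin 3) ℝ).toBasis (EuclideanSpace.basisFun (Fin 3) ℝ).toBasis
      (boxLin L : ℝ³ →ₗ[ℝ] ℝ³) = Matrix.diagonal (boxSide L) := by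
  ext i j
  rw [LinearMap.toMatrix_apply, Matrix.diagonal_apply]
  simp only [OrthonormalBasis.coe_toBasis, EuclideanSpace.basisFun_apply,
    OrthonormalBasis.coe_toBasis_repr_apply, EuclideanSpace.basisFun_repr, ContinuousLinearMap.coe_coe,
    boxLin_apply]
  by_cases h : i = j
  · subst h; simp
  · simp [h]

/-- **`det (boxLin L) = 16 L`.** [folklore] -/
theorem det_boxLin (L : ℝ) : (boxLin L).det = 16 * L := by
  rw [ContinuousLinearMap.det, ← LinearMap.det_toMatrix (EuclideanSpace.basisFun (Fin 3) ℝ).toBasis,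
    toMatrix_boxLin, Matrix.det_diagonal, Fin.prod_univ_three]
  simp only [boxSide_zero, boxSide_one, boxSide_two]
  ring

/-- **Change of variables through the box map**:
`∫_{B_L} G = 16 L ∫_{(0,1)³} G ∘ boxMap L` for `G ≥ 0` (`L > 0`). [folklore] -/
theorem setLIntegral_openBox_eq {L : ℝ} (hL : 0 < L) (G : ℝ³ → ℝ≥0∞) :
    ∫⁻ x in openBox L, G x = ENNReal.ofReal (16 * L) * ∫⁻ y in openCube, G (boxMap L y) := by
  have hcv := lintegral_image_eq_lintegral_abs_det_fderiv_mul volume isOpen_openCube.measurableSet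
    (fun y _ => (hasFDerivAt_boxMap L y).hasFDerivWithinAt) (boxMap_injective hL.ne').injOn G
  rw [image_boxMap_openCube hL] at hcv
  rw [hcv, ← lintegral_const_mul' _ _ ENNReal.ofReal_ne_top]
  refine setLIntegral_congr_fun isOpen_openCube.measurableSet fun y _ => ?_
  rw [det_boxLin, abs_of_pos (by positivity)]

/-! ### Chain rule for word derivatives through the box map -/

/-- The scaling factor `∏_{i ∈ w} aᵢ` of a word. [folklore] -/
def boxScale (L : ℝ) (w : List (Fin 3)) : ℝ := (w.map (boxSide L)).prod

/-- `boxScale` of nil. [folklore] -/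
@[simp] theorem boxScale_nil (L : ℝ) : boxScale L [] = 1 := by simp [boxScale]

/-- `boxScale` of a cons. [folklore] -/
@[simp] theorem boxScale_cons (L : ℝ) (i : Fin 3) (w : List (Fin 3)) :
    boxScale L (i :: w) = boxSide L i * boxScale L w := by simp [boxScale]

/-- The scaling factor is positive for `L > 0`. [folklore] -/
theorem boxScale_pos {L : ℝ} (hL : 0 < L) : ∀ w : List (Fin 3), 0 < boxScale L w
  | [] => by simp
  | i :: w => by rw [boxScale_cons]; exact mul_pos (boxSide_pos hL i) (boxScale_pos hL w)

/-- The scaling factor is nonzero for `L ≠ 0`. [folklore] -/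
theorem boxScale_ne_zero {L : ℝ} (hL : L ≠ 0) : ∀ w : List (Fin 3), boxScale L w ≠ 0
  | [] => by simp
  | i :: w => by rw [boxScale_cons]; exact mul_ne_zero (boxSide_ne_zero hL i) (boxScale_ne_zero hL w)

/-- `boxScale L w ≤ max(4, L)^{|w|}`. [folklore] -/
theorem boxScale_le_pow {L : ℝ} (hL : 0 < L) : ∀ w : List (Fin 3), boxScale L w ≤ (max 4 L) ^ w.length
  | [] => by simp
  | i :: w => by
    rw [boxScale_cons, List.length_cons, pow_succ']
    exact mul_le_mul (boxSide_le_max L i) (boxScale_le_pow hL w) (boxScale_pos hL w).le (by positivity)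

/-- `min(4, L)^{|w|} ≤ boxScale L w`. [folklore] -/
theorem pow_le_boxScale {L : ℝ} (hL : 0 < L) : ∀ w : List (Fin 3), (min 4 L) ^ w.length ≤ boxScale L w
  | [] => by simp
  | i :: w => by
    rw [boxScale_cons, List.length_cons, pow_succ']
    exact mul_le_mul (min_le_boxSide L i) (pow_le_boxScale hL w) (by positivity) (boxSide_pos hL i).le

/-- **Chain rule for word derivatives through the box map**:
`∂_w (g ∘ boxMap L) = boxScale L w • (∂_w g) ∘ boxMap L` for smooth `g`. [folklore] -/
theorem iterDirDeriv_comp_boxMap (L : ℝ) {g : ℝ³ → F} (hg : ContDiff ℝ ∞ g) : ∀ w : List (Fin 3),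
    iterDirDeriv (Torus.wordVecs w) (fun y => g (boxMap L y)) =
      fun y => boxScale L w • iterDirDeriv (Torus.wordVecs w) g (boxMap L y)
  | [] => by funext y; simp [Torus.wordVecs]
  | i :: w => by
    have ih := iterDirDeriv_comp_boxMap L hg w
    have hGd : Differentiable ℝ (iterDirDeriv (Torus.wordVecs w) g) :=
      (contDiff_iterDirDeriv hg _).differentiable (by simp)
    funext y
    rw [Torus.wordVecs_cons, iterDirDeriv_cons, iterDirDeriv_cons, ih, boxScale_cons]
    have h1 : HasFDerivAt (fun y => boxScale L w • iterDirDeriv (Torus.wordVecs w) g (boxMap L y))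
        (boxScale L w • (fderiv ℝ (iterDirDeriv (Torus.wordVecs w) g) (boxMap L y)).comp (boxLin L)) y :=
      ((hGd _).hasFDerivAt.comp y (hasFDerivAt_boxMap L y)).const_smul _
    show fderiv ℝ (fun y => boxScale L w • iterDirDeriv (Torus.wordVecs w) g (boxMap L y)) y
        (EuclideanSpace.single i 1) =
      (boxSide L i * boxScale L w) •
        fderiv ℝ (iterDirDeriv (Torus.wordVecs w) g) (boxMap L y) (EuclideanSpace.single i 1)
    rw [h1.fderiv]
    show boxScale L w • fderiv ℝ (iterDirDeriv (Torus.wordVecs w) g) (boxMap L y)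
        (boxLin L (EuclideanSpace.single i 1)) = _
    rw [boxLin_single, ContinuousLinearMap.map_smul, smul_smul, mul_comm]

/-- **Chain rule through the inverse box map**:
`∂_w (g ∘ boxInv L) = (boxScale L w)⁻¹ • (∂_w g) ∘ boxInv L` for smooth `g` (`L ≠ 0`). [folklore] -/
theorem iterDirDeriv_comp_boxInv {L : ℝ} (hL : L ≠ 0) {g : ℝ³ → F} (hg : ContDiff ℝ ∞ g) (w : List (Fin 3)) :
    iterDirDeriv (Torus.wordVecs w) (fun x => g (boxInv L x)) =
      fun x => (boxScale L w)⁻¹ • iterDirDeriv (Torus.wordVecs w) g (boxInv L x) := by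
  set h : ℝ³ → F := fun x => g (boxInv L x) with hh
  have hhs : ContDiff ℝ ∞ h := hg.comp (contDiff_boxInv L)
  have hgh : g = fun y => h (boxMap L y) := by
    funext y; simp only [hh, boxInv_boxMap hL]
  have key := iterDirDeriv_comp_boxMap L hhs w
  rw [← hgh] at key
  funext x
  have hx := congr_fun key (boxInv L x)
  simp only [boxMap_boxInv hL] at hx
  rw [hx, smul_smul, inv_mul_cancel₀ (boxScale_ne_zero hL w), one_smul]

/-! ### Reading a box field on the torus -/

/-- `|x₀| ≤ r(x)` and `|x₁| ≤ r(x)`. [folklore] -/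
theorem abs_apply_le_cylRadius (x : ℝ³) {i : Fin 3} (hi : i = 0 ∨ i = 1) : |x i| ≤ cylRadius x := by
  rw [cylRadius, ← Real.sqrt_sq_eq_abs]
  refine Real.sqrt_le_sqrt ?_
  rcases hi with rfl | rfl <;> nlinarith [sq_nonneg (x 0), sq_nonneg (x 1)]

/-- **Reading a box field on `T³`**: `toTorus L E ξ = E (boxMap L (repr ξ))`. [folklore] -/
def toTorus (L : ℝ) (E : ℝ³ → F) : UnitAddTorus (Fin 3) → F := fun ξ => E (boxMap L (repr ξ))

omit [NormedSpace ℝ F] in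
/-- `toTorus` is additive. [folklore] -/
theorem toTorus_add (L : ℝ) (E E' : ℝ³ → F) : toTorus L (E + E') = toTorus L E + toTorus L E' := rfl

/-- `toTorus` is homogeneous. [folklore] -/
theorem toTorus_smul (L : ℝ) (c : ℝ) (E : ℝ³ → F) : toTorus L (c • E) = c • toTorus L E := rfl

/-- The support hypothesis of the transfer: `E` vanishes where `|x₀| ≥ 5/4` or `|x₁| ≥ 5/4`
(satisfied by anything vanishing on `{r ≥ 5/4}`, e.g. `cylExtend f`). [folklore] -/
def VanishesOffCore (E : ℝ³ → F) : Prop := ∀ x : ℝ³, (5 / 4 ≤ |x 0| ∨ 5 / 4 ≤ |x 1|) → E x = 0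

omit [NormedSpace ℝ F] in
/-- Functions vanishing on `{r ≥ 5/4}` vanish off the core. [folklore] -/
theorem vanishesOffCore_of_cylRadius {E : ℝ³ → F} (h : ∀ x : ℝ³, 5 / 4 ≤ cylRadius x → E x = 0) :
    VanishesOffCore E := fun x hx =>
  h x (hx.elim (fun h0 => h0.trans (abs_apply_le_cylRadius x (Or.inl rfl)))
    fun h1 => h1.trans (abs_apply_le_cylRadius x (Or.inr rfl)))

/-- The radial Seeley extension vanishes off the core. [folklore] -/
theorem vanishesOffCore_cylExtend (f : ℝ³ → F) : VanishesOffCore (cylExtend f) :=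
  vanishesOffCore_of_cylRadius fun _ hx => cylExtend_eq_zero hx

omit [NormedSpace ℝ F] in
/-- Sums of functions vanishing off the core vanish off the core. [folklore] -/
theorem VanishesOffCore.add {E E' : ℝ³ → F} (hE : VanishesOffCore E) (hE' : VanishesOffCore E') :
    VanishesOffCore (E + E') := fun x hx => by
  rw [Pi.add_apply, hE x hx, hE' x hx, add_zero]

/-- Multiples of functions vanishing off the core vanish off the core. [folklore] -/
theorem VanishesOffCore.smul {E : ℝ³ → F} (hE : VanishesOffCore E) (c : ℝ) :
    VanishesOffCore (c • E) := fun x hx => by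
  rw [Pi.smul_apply, hE x hx, smul_zero]

omit [NormedAddCommGroup F] [NormedSpace ℝ F] in
/-- `E ∘ boxMap L` is `1`-periodic in `y₂` when `E` is `L`-periodic in `z`. [folklore] -/
theorem comp_boxMap_add_single_two {L : ℝ} {E : ℝ³ → F} (hper : IsAxiallyPeriodic L E) (y : ℝ³) :
    E (boxMap L (y + EuclideanSpace.single 2 1)) = E (boxMap L y) := by
  have : boxMap L (y + EuclideanSpace.single 2 1) = boxMap L y + L • EuclideanSpace.single (2 : Fin 3) (1 : ℝ) := by
    refine ext3 ?_ ?_ ?_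
    · simp [boxMap_apply_zero]
    · simp [boxMap_apply_one]
    · simp [boxMap_apply_two, mul_add]
  rw [this, hper]

omit [NormedSpace ℝ F] in
/-- `E ∘ boxMap L` vanishes near the lateral faces of the unit cube when `E` vanishes off the
core (margin `δ = 3/16`: `|4y₀ - 2| ≥ 5/4` there). [folklore] -/
theorem comp_boxMap_eq_zero_of_margin {L : ℝ} {E : ℝ³ → F} (hE : VanishesOffCore E) (y : ℝ³)
    (hy : y 0 ≤ 3 / 16 ∨ 1 - 3 / 16 ≤ y 0 ∨ y 1 ≤ 3 / 16 ∨ 1 - 3 / 16 ≤ y 1) : E (boxMap L y) = 0 := by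
  apply hE
  rcases hy with h | h | h | h
  · left; rw [boxMap_apply_zero, le_abs]; right; linarith
  · left; rw [boxMap_apply_zero, le_abs]; left; linarith
  · right; rw [boxMap_apply_one, le_abs]; right; linarith
  · right; rw [boxMap_apply_one, le_abs]; left; linarith

/-- **`toTorus L E` is smooth** for `E` smooth, `L`-periodic in `z` and vanishing off the core.
[folklore] -/
theorem isSmooth_toTorus {L : ℝ} {E : ℝ³ → F} (hE : ContDiff ℝ ∞ E) (hper : IsAxiallyPeriodic L E)
    (h0 : VanishesOffCore E) : IsSmooth (toTorus L E) :=
  isSmooth_comp_repr (G := fun y => E (boxMap L y)) (hE.comp (contDiff_boxMap L))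
    (comp_boxMap_add_single_two hper) (by norm_num) (comp_boxMap_eq_zero_of_margin h0)

omit [NormedAddCommGroup F] [NormedSpace ℝ F] in
/-- On the half-open unit cube the lift of `toTorus L E` is `E ∘ boxMap L`. [folklore] -/
theorem lift_toTorus_of_mem_unitCube (L : ℝ) (E : ℝ³ → F) {y : ℝ³} (hy : y ∈ unitCube (Fin 3)) :
    lift (toTorus L E) y = E (boxMap L y) := by
  rw [lift_apply, toTorus, repr_proj_of_mem_unitCube_holds hy]

/-- **On the open unit cube all word derivatives of the lift of `toTorus L E` are those of
`E ∘ boxMap L`.** [folklore] -/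
theorem iterDirDeriv_lift_toTorus (L : ℝ) (E : ℝ³ → F) (w : List (Fin 3)) {y : ℝ³} (hy : y ∈ openCube) :
    iterDirDeriv (Torus.wordVecs w) (lift (toTorus L E)) y =
      iterDirDeriv (Torus.wordVecs w) (fun y => E (boxMap L y)) y := by
  have hev : lift (toTorus L E) =ᶠ[𝓝 y] fun y => E (boxMap L y) := by
    filter_upwards [isOpen_openCube.mem_nhds hy] with z hz
    exact lift_toTorus_of_mem_unitCube L E (openCube_subset_unitCube hz)
  exact (eventuallyEq_iterDirDeriv hev _).eq_of_nhds

/-- **Exact `L²` transfer for `toTorus`**: for `E` smooth, `L`-periodic in `z` and vanishing off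
the core, `16 L ∫_{T³} ‖∂_w (toTorus L E)‖ₑ² = (boxScale L w)² ∫_{B_L} ‖∂_w E‖ₑ²`. [folklore] -/
theorem lintegral_wordDeriv_toTorus_sq {L : ℝ} (hL : 0 < L) {E : ℝ³ → F} (hE : ContDiff ℝ ∞ E)
    (hper : IsAxiallyPeriodic L E) (h0 : VanishesOffCore E) (w : List (Fin 3)) :
    ENNReal.ofReal (16 * L) * ∫⁻ ξ, ‖Torus.wordDeriv w (toTorus L E) ξ‖ₑ ^ 2 =
      ENNReal.ofReal (boxScale L w ^ 2) * ∫⁻ x in openBox L, ‖iterDirDeriv (Torus.wordVecs w) E x‖ₑ ^ 2 := by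
  have hsm : IsSmooth (toTorus L E) := isSmooth_toTorus hE hper h0
  have h1 : ∫⁻ ξ, ‖Torus.wordDeriv w (toTorus L E) ξ‖ₑ ^ 2 =
      ∫⁻ y in openCube, ‖iterDirDeriv (Torus.wordVecs w) (fun y => E (boxMap L y)) y‖ₑ ^ 2 := by
    rw [← setLIntegral_unitCube_lift (Torus.aemeasurable_enorm_wordDeriv_sq hsm w),
      ← setLIntegral_congr openCube_ae_eq_unitCube]
    refine setLIntegral_congr_fun isOpen_openCube.measurableSet fun y hy => ?_
    show ‖lift (Torus.wordDeriv w (toTorus L E)) y‖ₑ ^ 2 = _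
    rw [Torus.lift_wordDeriv hsm, iterDirDeriv_lift_toTorus L E w hy]
  have h2 : ∫⁻ y in openCube, ‖iterDirDeriv (Torus.wordVecs w) (fun y => E (boxMap L y)) y‖ₑ ^ 2 =
      ENNReal.ofReal (boxScale L w ^ 2) *
        ∫⁻ y in openCube, ‖iterDirDeriv (Torus.wordVecs w) E (boxMap L y)‖ₑ ^ 2 := by
    rw [iterDirDeriv_comp_boxMap L hE w, ← lintegral_const_mul' _ _ ENNReal.ofReal_ne_top]
    refine lintegral_congr fun y => ?_
    show ‖boxScale L w • iterDirDeriv (Torus.wordVecs w) E (boxMap L y)‖ₑ ^ 2 = _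
    rw [enorm_smul, mul_pow, Real.enorm_eq_ofReal_abs, ← ENNReal.ofReal_pow (abs_nonneg _), sq_abs]
  rw [h1, h2, setLIntegral_openBox_eq hL]
  ring

/-- `(16 L)⁻¹ (boxScale L w)²` as one `ofReal`. [folklore] -/
theorem ofReal_boxScale_sq_div {L : ℝ} (hL : 0 < L) (w : List (Fin 3)) :
    ENNReal.ofReal (boxScale L w ^ 2 / (16 * L)) =
      (ENNReal.ofReal (16 * L))⁻¹ * ENNReal.ofReal (boxScale L w ^ 2) := by
  rw [ENNReal.ofReal_div_of_pos (by positivity), div_eq_mul_inv, mul_comm]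

/-- The one-sided form used downstream: `∫_{T³} ‖∂_w (toTorus L E)‖ₑ² ≤
(boxScale L w)² (16 L)⁻¹ ∫_{0 < z < L} ‖∂_w E‖ₑ²` (the box sits in the slab). [folklore] -/
theorem lintegral_wordDeriv_toTorus_sq_le {L : ℝ} (hL : 0 < L) {E : ℝ³ → F} (hE : ContDiff ℝ ∞ E)
    (hper : IsAxiallyPeriodic L E) (h0 : VanishesOffCore E) (w : List (Fin 3)) :
    ∫⁻ ξ, ‖Torus.wordDeriv w (toTorus L E) ξ‖ₑ ^ 2 ≤
      ENNReal.ofReal (boxScale L w ^ 2 / (16 * L)) *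
        ∫⁻ x in {x : ℝ³ | x 2 ∈ Ioo 0 L}, ‖iterDirDeriv (Torus.wordVecs w) E x‖ₑ ^ 2 := by
  have h16 : ENNReal.ofReal (16 * L) ≠ 0 := by simp [hL]
  have key := lintegral_wordDeriv_toTorus_sq hL hE hper h0 w
  have hsub : openBox L ⊆ {x : ℝ³ | x 2 ∈ Ioo 0 L} := fun x hx => hx.2.2
  calc ∫⁻ ξ, ‖Torus.wordDeriv w (toTorus L E) ξ‖ₑ ^ 2
      = (ENNReal.ofReal (16 * L))⁻¹ * (ENNReal.ofReal (16 * L) * ∫⁻ ξ, ‖Torus.wordDeriv w (toTorus L E) ξ‖ₑ ^ 2) := by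
        rw [← mul_assoc, ENNReal.inv_mul_cancel h16 ENNReal.ofReal_ne_top, one_mul]
    _ = ENNReal.ofReal (boxScale L w ^ 2 / (16 * L)) *
          ∫⁻ x in openBox L, ‖iterDirDeriv (Torus.wordVecs w) E x‖ₑ ^ 2 := by
        rw [key, ← mul_assoc, ofReal_boxScale_sq_div hL]
    _ ≤ _ := mul_le_mul_of_nonneg_left (lintegral_mono_set hsub) bot_le

/-! ### Reading a torus field on the box -/

/-- **Reading a torus field on `ℝ³`**: `fromTorus L V = lift V ∘ boxInv L`. [folklore] -/
def fromTorus (L : ℝ) (V : UnitAddTorus (Fin 3) → F) : ℝ³ → F := fun x => lift V (boxInv L x)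

omit [NormedSpace ℝ F] in
/-- `fromTorus` is additive. [folklore] -/
theorem fromTorus_add (L : ℝ) (V V' : UnitAddTorus (Fin 3) → F) :
    fromTorus L (V + V') = fromTorus L V + fromTorus L V' := rfl

/-- `fromTorus` is homogeneous. [folklore] -/
theorem fromTorus_smul (L : ℝ) (c : ℝ) (V : UnitAddTorus (Fin 3) → F) : fromTorus L (c • V) = c • fromTorus L V := rfl

/-- `fromTorus L V` is smooth for smooth `V`. [folklore] -/
theorem contDiff_fromTorus (L : ℝ) {V : UnitAddTorus (Fin 3) → F} (hV : IsSmooth V) :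
    ContDiff ℝ ∞ (fromTorus L V) :=
  (show ContDiff ℝ ∞ (lift V) from hV).comp (contDiff_boxInv L)

omit [NormedAddCommGroup F] [NormedSpace ℝ F] in
/-- `fromTorus L V` is `L`-periodic in `z` (`L ≠ 0`). [folklore] -/
theorem isAxiallyPeriodic_fromTorus {L : ℝ} (hL : L ≠ 0) (V : UnitAddTorus (Fin 3) → F) :
    IsAxiallyPeriodic L (fromTorus L V) := fun x => by
  have : boxInv L (x + L • EuclideanSpace.single (2 : Fin 3) (1 : ℝ)) =
      boxInv L x + latticeVec (Pi.single (2 : Fin 3) (1 : ℤ)) := by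
    refine ext3 ?_ ?_ ?_
    · simp [boxInv_apply_zero, latticeVec_apply]
    · simp [boxInv_apply_one, latticeVec_apply]
    · simp [boxInv_apply_two, latticeVec_apply, add_div, hL]
  simp only [fromTorus, lift_apply, this, proj_add_latticeVec]

/-- **Word derivatives of `fromTorus L V`** are read off the torus:
`∂_w (fromTorus L V) = (boxScale L w)⁻¹ • fromTorus L (∂_w V)` (`L ≠ 0`). [folklore] -/
theorem iterDirDeriv_fromTorus {L : ℝ} (hL : L ≠ 0) {V : UnitAddTorus (Fin 3) → F} (hV : IsSmooth V)
    (w : List (Fin 3)) :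
    iterDirDeriv (Torus.wordVecs w) (fromTorus L V) =
      fun x => (boxScale L w)⁻¹ • fromTorus L (Torus.wordDeriv w V) x := by
  have := iterDirDeriv_comp_boxInv hL (show ContDiff ℝ ∞ (lift V) from hV) w
  simp only [fromTorus, Torus.lift_wordDeriv hV]
  exact this

/-- **Exact `L²` transfer for `fromTorus`**:
`(boxScale L w)² ∫_{B_L} ‖∂_w (fromTorus L V)‖ₑ² = 16 L ∫_{T³} ‖∂_w V‖ₑ²`. [folklore] -/
theorem lintegral_iterDirDeriv_fromTorus_sq {L : ℝ} (hL : 0 < L) {V : UnitAddTorus (Fin 3) → F}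
    (hV : IsSmooth V) (w : List (Fin 3)) :
    ENNReal.ofReal (boxScale L w ^ 2) * ∫⁻ x in openBox L, ‖iterDirDeriv (Torus.wordVecs w) (fromTorus L V) x‖ₑ ^ 2 =
      ENNReal.ofReal (16 * L) * ∫⁻ ξ, ‖Torus.wordDeriv w V ξ‖ₑ ^ 2 := by
  have hs := boxScale_pos hL w
  have hpt : ∀ y : ℝ³, ‖(boxScale L w)⁻¹ • fromTorus L (Torus.wordDeriv w V) (boxMap L y)‖ₑ ^ 2 =
      ENNReal.ofReal ((boxScale L w)⁻¹ ^ 2) * ‖lift (Torus.wordDeriv w V) y‖ₑ ^ 2 := fun y => by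
    rw [fromTorus, boxInv_boxMap hL.ne', enorm_smul, mul_pow, Real.enorm_eq_ofReal_abs,
      ← ENNReal.ofReal_pow (abs_nonneg _), sq_abs]
  calc ENNReal.ofReal (boxScale L w ^ 2) *
        ∫⁻ x in openBox L, ‖iterDirDeriv (Torus.wordVecs w) (fromTorus L V) x‖ₑ ^ 2
      = ENNReal.ofReal (boxScale L w ^ 2) * (ENNReal.ofReal (16 * L) *
          ∫⁻ y in openCube, ‖(boxScale L w)⁻¹ • fromTorus L (Torus.wordDeriv w V) (boxMap L y)‖ₑ ^ 2) := by
        rw [iterDirDeriv_fromTorus hL.ne' hV w, setLIntegral_openBox_eq hL]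
    _ = ENNReal.ofReal (boxScale L w ^ 2) * (ENNReal.ofReal (16 * L) *
          (ENNReal.ofReal ((boxScale L w)⁻¹ ^ 2) * ∫⁻ y in openCube, ‖lift (Torus.wordDeriv w V) y‖ₑ ^ 2)) := by
        simp only [hpt]
        rw [lintegral_const_mul' _ _ ENNReal.ofReal_ne_top]
    _ = ENNReal.ofReal (16 * L) * ∫⁻ y in openCube, ‖lift (Torus.wordDeriv w V) y‖ₑ ^ 2 := by
        rw [← mul_assoc, ← mul_assoc, mul_comm (ENNReal.ofReal (boxScale L w ^ 2)), mul_assoc (ENNReal.ofReal (16 * L)),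
          ← ENNReal.ofReal_mul (sq_nonneg _), ← mul_pow, mul_inv_cancel₀ hs.ne', one_pow, ENNReal.ofReal_one,
          mul_one]
    _ = ENNReal.ofReal (16 * L) * ∫⁻ ξ, ‖Torus.wordDeriv w V ξ‖ₑ ^ 2 := by
        rw [setLIntegral_congr openCube_ae_eq_unitCube]
        exact congrArg _ (setLIntegral_unitCube_lift (Torus.aemeasurable_enorm_wordDeriv_sq hV w))

omit [NormedAddCommGroup F] [NormedSpace ℝ F] in
/-- **`fromTorus L (toTorus L E) = E` on `[-2, 2)² × ℝ`** for `E` `L`-periodic in `z` (`L > 0`).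
[folklore] -/
theorem fromTorus_toTorus_apply {L : ℝ} (hL : 0 < L) {E : ℝ³ → F} (hper : IsAxiallyPeriodic L E) {x : ℝ³}
    (hx0 : x 0 ∈ Ico (-2 : ℝ) 2) (hx1 : x 1 ∈ Ico (-2 : ℝ) 2) : fromTorus L (toTorus L E) x = E x := by
  simp only [fromTorus, toTorus, lift_apply]
  -- the representative of `proj (boxInv L x)` differs from `boxInv L x` by an integer in `y₂` only
  set n : ℤ := ⌊x 2 / L⌋ with hn
  have c0 : boxInv L x 0 ∈ Ico (0 : ℝ) 1 := by
    rw [boxInv_apply_zero]; constructor <;> linarith [hx0.1, hx0.2]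
  have c1 : boxInv L x 1 ∈ Ico (0 : ℝ) 1 := by
    rw [boxInv_apply_one]; constructor <;> linarith [hx1.1, hx1.2]
  have hrepr : repr (proj (boxInv L x)) = boxInv L x - latticeVec (Pi.single (2 : Fin 3) n) := by
    refine ext3 ?_ ?_ ?_
    · rw [repr_proj_apply, PiLp.sub_apply, latticeVec_apply, Int.fract_eq_self.2 c0]; simp
    · rw [repr_proj_apply, PiLp.sub_apply, latticeVec_apply, Int.fract_eq_self.2 c1]; simp
    · rw [repr_proj_apply, PiLp.sub_apply, latticeVec_apply, boxInv_apply_two, Int.fract]; simp [hn]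
  have hbox : boxMap L (boxInv L x - latticeVec (Pi.single (2 : Fin 3) n)) =
      x + (((-n : ℤ) : ℝ) * L) • EuclideanSpace.single (2 : Fin 3) (1 : ℝ) := by
    refine ext3 ?_ ?_ ?_
    · simp [boxMap_apply_zero, latticeVec_apply]; ring
    · simp [boxMap_apply_one, latticeVec_apply]; ring
    · simp [boxMap_apply_two, latticeVec_apply, mul_sub]
      rw [mul_div_cancel₀ _ hL.ne']
      ring
  rw [hrepr, hbox]
  exact hper.add_int_mul (-n) x

end PeriodicCylinder

end Literature.Analysis.FluidPDE
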